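import Mathlib
import Literature.NumberTheory.Transcendental.ProjectiveSpace
import HarnessLib

/-!
# The archimedean height package of a biextension line bundle on `ℙᴺ(ℂ) ∖ D` (hypothesis structure)

Family `hodge`, layer `Literature/AlgebraicGeometry/HodgeTheory`. Requested by route
`HodgeConjecture/HeightMassDefect` to TYPE its cruxes (`MassDefect`: `M_j(k) < δ_k^j`;
`InteriorMassAsymptotics`, `HeightDegreeFormula`, `MassDefectDetectsSingularity`).

**Mathematics (as printed).** Let `S = P̄ ∖ X̂`, `P̄ = |L| ≅ ℙᴺ`, be the locus of smooth members of a
complete linear system on a smooth projective `X^{2m}`, `ℋ` the variation of Hodge structure of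
weight `-1` on the variable cohomology of the hyperplane sections, `ν = ν_ζ ∈ ANF(S, ℋ)` the
admissible normal function of a primitive Hodge class `ζ` (BP §1.1). Hain–Reed: the isomorphism
classes of biextension variations `𝒱` of type `(ν, ν^∨)` over opens of `S` are the non-vanishing
sections of an analytic line bundle `ℒ = ℒ(ν, ν^∨)` carrying the metric `|𝒱| = exp(-h(𝒱))`, `h`
Hain's height `2π δ_{(F,W)} = h · η` defined through Deligne's `δ`-splitting (BP §1 and Def. 22,
Prop. 24: `|t.b| = |t| |b|`); `h(𝒱) ∈ C^∞(S)` is PLURISUBHARMONIC (BP Thm. 16 = PP Thm. 8.2,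
Cor. 8.3: `∂²δ/∂s∂s̄ = ‖infinitesimal invariant of ν‖² ≥ 0` along curves). `ℒ` extends to a line
bundle on `P̄` (BP Thm. 137 = "Thm. eb1": one extension `ℒ̄_τ̃` for each choice of representatives
`τ̃_i ∈ ℚ` of the torsion pairings `τ_i ∈ ℚ/ℤ` of the codimension-one boundary components `Y_i`,
characterised by `μ(φ^*𝒱) = τ̃_i` for its non-vanishing sections `𝒱` and every test curve `φ`
meeting `Y_i` transversally at a smooth point of the boundary), canonically to
`ℒ̄_can ∈ Pic(P̄) ⊗ ℚ = ℚ · 𝒪(1)` ("all `τ̃_i = 0`", BP Rem. 138 = "Rem. canext"); along a test curve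
`φ : (Δ, 0) → (P̄, p)`, `φ(Δ^*) ⊂ S`, one has `h(𝒱_{φ(s)}) ∼ -μ log|s|` with `μ ∈ ℚ` and
`h + μ log|s| → ht(N, F, W)` (BP Property 11, Thm. 43; unipotent monodromy, the general case after
the base change `s = t^e`).

**Rendering.** None of `ℋ, ν, 𝒱, δ`-splittings exists in Lean, so THE height is not nameable; what
the route consumes is (a) the curvature form `β = dd^c h = c₁(ℒ, |·|)` (`dd^c = (i/π) ∂∂̄`, so that
`c₁ = dd^c(-log|frame|)`), (b) its growth at `D := X̂`, and (c) the numbers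
`δ = ∫_S β ∧ ω_FS^{N-1}`, `M_j = ∫_S β^j ∧ ω_FS^{N-j}`. We record the metrised `ℚ`-line bundle
`(ℒ̄_can, |·|)` by the one honest datum that determines all of this: its CONE POTENTIAL
`pot : ℂ^{N+1} → ℝ`, `pot(v) = (1/e) log (|σ(v)| / ‖σ([v])‖)` for any `σ ≠ 0` in the fibre at `[v]` of
the genuine line bundle `𝒪(e d) ≅ ℒ^{⊗e} ⊗ 𝒪(e Σ τ̃_i Y_i)` (`e τ̃_i ∈ ℤ`; over `S` the second factor is
canonically trivial and the metric is `|·|^{⊗e}`), `d ∈ ℚ` the class of `ℒ̄_can` [folklore dictionary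
metrics on `𝒪(d)` ↔ functions on the cone, log-homogeneous of degree `d`]: locally over `S`,
`pot = h(𝒱) + log|F_𝒱|` with `F_𝒱` holomorphic non-vanishing, so `dd^c pot = π^* β`, `pot` is smooth
and psh on the cone over `S`, has the printed growth along discs, and is BOUNDED along transversal
discs at smooth hypersurface points of `D` (this is `τ̃_i = 0`, i.e. the normalisation `ℒ̄_can`; it
fixes `(pot, d)` up to an additive constant). The structure `BiextensionHeightPackage N D` bundles
`pot`, `d` and exactly these printed properties as hypothesis fields (pattern
`HardLefschetzThreefold`); the numbers are DEFINED from `pot` (`massENN`, `degreeENN`: Lebesgue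
integrals over the affine chart `{z₀ ≠ 0}` — full measure — of the mixed discriminants of the
complex Hessian of `pot` against Fubini–Study, `BiextensionHeight.heightDensity`), and the two
inequalities the route quotes are fields citing their sources: `δ < ∞` (the extension `Ť` of `β`
by zero is a closed positive current on `ℙᴺ` of finite degree — BP Thm. 17: near normal-crossing
boundary points with unipotent monodromy and `μ_j ≥ 0`, `h̄ = h + Σ μ_j log|s_j|` extends
plurisubharmonically (Thms. 14, 16 and Grauert–Remmert), so `β = dd^c h̄` off `D` is dominated by a
positive current of locally finite mass and extends by zero to a closed positive current, Skoda–El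
Mir, as recalled in BEGZ §1.2) and `M_j ≤ δ^j` (BEGZ Def. 1.2, Props. 1.6, 1.20: `⟨Ť^j⟩` is the
trivial extension of the smooth form `β^j`, of mass `≤ {Ť}^j · {ω}^{N-j} = δ^j`).

**Junk analysis (read before typing route items).** `pot := 0, d := 0` inhabits
`BiextensionHeightPackage N D` for every `D` (all printed properties are inequalities/regularity);
hence `Nonempty (BiextensionHeightPackage N D)` is NOT the construction statement and no
existence/uniqueness fact is vendored here. Statements `∀ P : BiextensionHeightPackage N D, …`
about the numbers are false for junk `P`; route items about THE height of `ν_{ζ,k}` must take the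
package as an explicit datum `P` together with the hypotheses tying it to `ν` (the dictionary
`sing_p ν ≠ 0 ↔ jump`, BP Cor. 7/Thm. 13, and KP (3-7) belong to the notion
`AdmissibleNormalFunctionSingularity`, which also supplies `N = N_k` and `D = X̂_k`).

**What is NOT here.** Normal functions, `sing_p`, the dual variety (sibling notion); currents,
Lelong numbers, non-pluripolar products as objects (notion `NonPluripolarMongeAmpereMass`; here only
the resulting numbers, which for smooth `β` on `S` are the classical integrals); BP Thm. 14
(continuity of `h + μ log|s₁|` across smooth boundary points: needs "unipotent monodromy", not
expressible); the expected identity `d = δ` (Chern–Weil on a generic line: not in print, crux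
`HeightDegreeFormula`); the codimension-one Lear coefficient, canonical only in `ℚ/ℤ` (`= τ_i`, BP
§14.1) and `0` in the `ℒ̄_can` normalisation used here.

## References

* [BrosnanPearlstein2019] P. Brosnan, G. Pearlstein, Jumps in the Archimedean height, Duke Math. J.
  168 (2019); arXiv:1701.05527: §1 (ℒ, metric, Q2/Q3), Cor. 7, Conj. 8, Thm. 9, Property 11, Rem. 12,
  Thms. 13, 14, 16, 17; Def. 22, Prop. 24; Thm. 43; §14 Thm. 137 (eb1), Rem. 138 (canext).
* [PearlsteinPeters2019] G. Pearlstein, C. Peters, Differential geometry of the mixed Hodge metric,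
  Comm. Anal. Geom. 27 (2019), §8 Thms. 8.1, 8.2, Cor. 8.3.
* [HainReed2004] R. Hain, D. Reed, J. Differential Geom. 67 (2004) (biextension line bundle).
* [BoucksomEtAl2010] Boucksom–Eyssidieux–Guedj–Zeriahi, Acta Math. 205 (2010), Def. 1.1, 1.2,
  Prop. 1.6, Prop. 1.20, Def. 1.21.
* H. Skoda, Invent. Math. 66 (1982), 361–376; H. El Mir, Acta Math. 153 (1984), 1–45 (extension by
  zero of closed positive currents; recalled in [BoucksomEtAl2010] §1.2); H. Grauert, R. Remmert,
  Math. Z. 65 (1956) (extension of psh functions; used in BP Thm. 17).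
* [KerrPearlstein2011] M. Kerr, G. Pearlstein, §3.2–3.3 (the geometric situation `P̄ = |kH|`).
-/

noncomputable section

open scoped Topology ContDiff ComplexOrder LinearAlgebra.Projectivization
open MeasureTheory Filter Set

namespace Literature.AlgebraicGeometry.HodgeTheory

/-! ### Chart calculus: complex Hessian, Fubini–Study, mixed-discriminant densities -/

namespace BiextensionHeight

variable {n : ℕ}

/-- The **complex Hessian** (Levi matrix) `A_{pq}(w) = ∂²g/∂w_p∂w̄_q (w)` of a real function `g` on
`ℂⁿ`, written through the real second derivative `H = D²g(w)` (`iteratedFDeriv ℝ 2`): with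
`∂_{w_p} = ½(∂_{x_p} - i ∂_{y_p})`, `∂_{w̄_q} = ½(∂_{x_q} + i ∂_{y_q})` and `e_p` the standard basis,
`A_{pq} = ¼ (H(e_p, e_q) + H(i e_p, i e_q)) + ¼ i (H(e_p, i e_q) - H(i e_p, e_q))`; it is Hermitian when
`H` is symmetric, `Σ_{pq} A_{pq} ξ_p ξ̄_q` is the Levi form, and a `C²` function is plurisubharmonic on
an open set iff `A ≥ 0` there. Junk (`0`) where `g` is not twice differentiable. [folklore] -/
def leviMatrix (g : (Fin n → ℂ) → ℝ) (w : Fin n → ℂ) : Matrix (Fin n) (Fin n) ℂ :=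
  fun p q ↦
    (((iteratedFDeriv ℝ 2 g w ![Pi.single p 1, Pi.single q 1]
        + iteratedFDeriv ℝ 2 g w ![Complex.I • Pi.single p 1, Complex.I • Pi.single q 1] : ℝ) : ℂ)
      + ((iteratedFDeriv ℝ 2 g w ![Pi.single p 1, Complex.I • Pi.single q 1]
        - iteratedFDeriv ℝ 2 g w ![Complex.I • Pi.single p 1, Pi.single q 1] : ℝ) : ℂ) * Complex.I)
      / 4

/-- The affine Fubini–Study potential `u(w) = ½ log (1 + Σ_p |w_p|²)` on the chart `ℂⁿ = {z₀ ≠ 0}` of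
`ℙⁿ(ℂ)`: `ω_FS = dd^c u` for `dd^c = (i/π) ∂∂̄`, normalised so that `∫_{ℂⁿ} ω_FS^n = 1` (`ω_FS`
represents the hyperplane class). [folklore] -/
def fsPotential (w : Fin n → ℂ) : ℝ :=
  Real.log (1 + ∑ p, ‖w p‖ ^ 2) / 2

/-- The **height density of order `j`**: the density of the top form `(dd^c g)^j ∧ ω_FS^{n-j}` with
respect to Lebesgue measure `dλ = Π_p dx_p dy_p` on `ℂⁿ`, namely `n! (2/π)^n · D_j(A, G)` where
`A = leviMatrix g w`, `G = leviMatrix fsPotential w` and `D_j(A, G) = [s^j] det(s A + G) / (n choose j)`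
is the mixed discriminant with `j` entries `A` and `n - j` entries `G` (for `(1,1)`-forms
`α_k = (i/π) Σ (A_k)_{pq} dw_p ∧ dw̄_q` one has `α_1 ∧ ⋯ ∧ α_n = n! D(A_1, …, A_n) (2/π)^n dλ`, since
`(i/π) dw ∧ dw̄ = (2/π) dx ∧ dy`). Real part taken (the coefficient is real for Hermitian `A`, `G`);
junk `0` for `j > n`. [folklore] -/
def heightDensity (j : ℕ) (g : (Fin n → ℂ) → ℝ) (w : Fin n → ℂ) : ℝ :=
  (n.factorial : ℝ) * (2 / Real.pi) ^ n / (n.choose j : ℝ) *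
    (((Polynomial.X : Polynomial ℂ) • (leviMatrix g w).map Polynomial.C
        + (leviMatrix fsPotential w).map Polynomial.C).det.coeff j).re

variable {N : ℕ}

/-- The affine chart `w ↦ (1, w)` of the cone `ℂ^{N+1} ∖ 0 → ℙᴺ(ℂ)` over `U₀ = {z₀ ≠ 0}` (the vector
`Fin.insertNth 0 1 w` of the tree's `Projectivization.stdChartInv 0`). [folklore] -/
def chartVec (w : Fin N → ℂ) : Fin (N + 1) → ℂ :=
  Fin.insertNth 0 (1 : ℂ) w

/-- The part of the affine chart `ℂᴺ = {z₀ ≠ 0}` lying over the complement of `D ⊆ ℙᴺ(ℂ)`: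
`{w | (1, w) ∉ C(D)}`, `C(D) = {0} ∪ π⁻¹(D)` the affine cone (`Projectivization.conePreimage`). For `D`
a proper Zariski-closed subset this is the complement of a null set in `ℂᴺ`. [folklore] -/
def chartDomain (D : Set (ℙ ℂ (Fin (N + 1) → ℂ))) : Set (Fin N → ℂ) :=
  {w | chartVec w ∉ Projectivization.conePreimage D}

/-- **Mass of order `j`** of a cone potential `h : ℂ^{N+1} → ℝ` off `D`:
`∫_{chart ∖ D} (dd^c g)^j ∧ ω_FS^{N-j}`, `g = h ∘ chartVec` the chart potential, as the lower Lebesgue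
integral of the positive part of `heightDensity j g` (values in `[0, ∞]`; for a psh `g` the density is
`≥ 0`, so nothing is truncated). For `j = 1` this is the DEGREE `∫ dd^c g ∧ ω_FS^{N-1}` of the
current `dd^c g` extended by zero. [cite: BoucksomEtAl2010, Def. 1.1–1.2] -/
def massOf (D : Set (ℙ ℂ (Fin (N + 1) → ℂ))) (h : (Fin (N + 1) → ℂ) → ℝ) (j : ℕ) : ENNReal :=
  ∫⁻ w in chartDomain D, ENNReal.ofReal (heightDensity j (fun w' ↦ h (chartVec w')) w)

end BiextensionHeight

open BiextensionHeight

/-! ### The package -/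

/-- **The archimedean height package of the biextension line bundle on `ℙᴺ(ℂ) ∖ D`** (hypothesis
structure; intended instance: `D = X̂` the dual variety of `X^{2m}` re-embedded by `|kH| ≅ ℙᴺ`,
`ℒ = ℒ(ν_ζ, ν_ζ^∨)` the Hain–Reed biextension line bundle of the admissible normal function of a
primitive Hodge class `ζ`, with its metric `|𝒱| = e^{-h(𝒱)}`, BP §1, §1.1). DATA: the cone potential
`pot` of the metrised `ℚ`-line bundle `(ℒ̄_can, |·|)` (module docstring) and the class
`extDegree = d` of `ℒ̄_can ∈ Pic(ℙᴺ) ⊗ ℚ ≅ ℚ`. FIELDS: exactly the printed properties of `h` transported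
to `pot` (smooth, plurisubharmonic, rational logarithmic growth along discs, bounded along
transversal discs at smooth boundary points = the `ℒ̄_can` normalisation) and the two inequalities on
the derived numbers `degreeENN = δ`, `massENN j = M_j` quoted by the route. `pot` is junk on the
cone `C(D)` over `D` (which contains `0`).
[cite: BrosnanPearlstein2019, §1 (ℒ, metric), §1.2 Property 11, Thms. 13, 14, 16, 17; Thm. 43; §14 Thm. 137, Rem. 138]
[cite: PearlsteinPeters2019, Thm. 8.2 and Cor. 8.3] [cite: BoucksomEtAl2010, Def. 1.2, Prop. 1.6, Prop. 1.20] -/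
structure BiextensionHeightPackage (N : ℕ) (D : Set (ℙ ℂ (Fin (N + 1) → ℂ))) where
  /-- The cone potential `pot(v) = (1/e) log(|σ(v)| / ‖σ([v])‖)` of `(ℒ̄_can, |·|)` on `ℂ^{N+1}`; over
  `S = ℙᴺ ∖ D` locally `pot = h(𝒱) + log|F_𝒱|` (`𝒱` a local non-vanishing section, `F_𝒱` holomorphic
  non-vanishing), so `dd^c pot` descends to `β = dd^c h(𝒱) = c₁(ℒ, |·|)`. Junk on `C(D)`.
  [cite: BrosnanPearlstein2019, §1 (the metric on ℒ), Prop. 24, Thm. 137 and Rem. 138] -/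
  pot : (Fin (N + 1) → ℂ) → ℝ
  /-- The class `d ∈ ℚ` of the canonical extension `ℒ̄_can ∈ Pic(ℙᴺ) ⊗ ℚ = ℚ · [𝒪(1)]`.
  [cite: BrosnanPearlstein2019, §1 (Q2) and Rem. 138] -/
  extDegree : ℚ
  /-- Log-homogeneity: `pot(c v) = pot(v) + d log|c|` over `S` (a metric on `𝒪(d)` is a
  degree-`d` log-homogeneous function on the cone; `ℒ̄_can ≅ 𝒪(d)` in `Pic ⊗ ℚ`). [folklore]
  [cite: BrosnanPearlstein2019, Thm. 137 and Rem. 138] -/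
  pot_smul : ∀ (c : ℂ) (v : Fin (N + 1) → ℂ), c ≠ 0 → v ∉ Projectivization.conePreimage D →
    pot (c • v) = pot v + extDegree * Real.log ‖c‖
  /-- `h(𝒱)` is `C^∞` on `S` ("an associated `C^∞` function `h : S → ℝ`"), hence so is `pot` on the
  cone over `S`. [cite: BrosnanPearlstein2019, §1 (the function `h`, after eq. (type-H))] -/
  contDiffOn_pot : ContDiffOn ℝ ∞ pot (Projectivization.conePreimage D)ᶜ
  /-- **Plurisubharmonicity** (Pearlstein–Peters): for type `(ν, ν^∨)` the height `h(𝒱)` is psh on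
  `S` — `∂²δ/∂s∂s̄ = ‖∂ν‖² ≥ 0` along every curve — so the complex Hessian of `pot` is positive
  semidefinite on the cone over `S`. [cite: BrosnanPearlstein2019, Thm. 16]
  [cite: PearlsteinPeters2019, Thm. 8.2 and Cor. 8.3] -/
  posSemidef_leviMatrix : ∀ v, v ∉ Projectivization.conePreimage D → (leviMatrix pot v).PosSemidef
  /-- **Logarithmic growth along discs**: for a holomorphic disc `γ : (Δ, 0) → ℂ^{N+1}` with
  `γ(0) ≠ 0` over `D` and `γ(Δ^*)` over `S`, `pot(γ(s)) + μ log|s| → c` as `s → 0` for some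
  `μ ∈ ℚ`, `c ∈ ℝ` (`h(𝒱_{φ(s)}) ∼ -μ(𝒱)(m) log|s|` and `h + μ log|s| → ht(N, F, W)` for the
  admissible biextension `φ^*𝒱` over `Δ^*`, unipotent after a base change `s = t^e`).
  [cite: BrosnanPearlstein2019, Property 11, Rem. 12 and Thm. 43] -/
  exists_tendsto_pot_add_mul_log : ∀ γ : ℂ → (Fin (N + 1) → ℂ), AnalyticAt ℂ γ 0 → γ 0 ≠ 0 →
    γ 0 ∈ Projectivization.conePreimage D →
    (∀ᶠ s in 𝓝[≠] (0 : ℂ), γ s ∉ Projectivization.conePreimage D) →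
    ∃ (μ : ℚ) (c : ℝ), Tendsto (fun s ↦ pot (γ s) + μ * Real.log ‖s‖) (𝓝[≠] (0 : ℂ)) (𝓝 c)
  /-- **The `ℒ̄_can` normalisation** (`τ̃_i = 0`): at a point `v` over which `D` is locally the
  smooth hypersurface `{G = 0}` (`G` homogeneous, `dG(v) ≠ 0`), along every holomorphic disc
  through `v` transversal to `{G = 0}` and otherwise over `S`, `pot` has a finite limit (`μ = 0`:
  "`μ(φ^*𝒱) = τ̃_i` for every test curve meeting `Y_i` transversally", with the limit of Thm. 43).
  [cite: BrosnanPearlstein2019, Thm. 137, Rem. 138 and Thm. 43] -/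
  exists_tendsto_pot_of_transversal : ∀ (v : Fin (N + 1) → ℂ) (G : MvPolynomial (Fin (N + 1)) ℂ),
    v ≠ 0 → v ∈ Projectivization.conePreimage D → (∃ e : ℕ, G.IsHomogeneous e) →
    (∀ᶠ u in 𝓝 v, u ∈ Projectivization.conePreimage D ↔ MvPolynomial.eval u G = 0) →
    fderiv ℂ (fun u ↦ MvPolynomial.eval u G) v ≠ 0 →
    ∀ γ : ℂ → (Fin (N + 1) → ℂ), AnalyticAt ℂ γ 0 → γ 0 = v →
      deriv (fun s ↦ MvPolynomial.eval (γ s) G) 0 ≠ 0 →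
      (∀ᶠ s in 𝓝[≠] (0 : ℂ), γ s ∉ Projectivization.conePreimage D) →
      ∃ c : ℝ, Tendsto (fun s ↦ pot (γ s)) (𝓝[≠] (0 : ℂ)) (𝓝 c)
  /-- **Finite degree** (hypothesis): `δ = ∫_S β ∧ ω_FS^{N-1} < ∞`, i.e. `β` has locally finite mass
  near `D` and its extension by zero `Ť` is a closed positive current on `ℙᴺ` of finite degree — near
  normal-crossing boundary points with unipotent monodromy and `μ_j ≥ 0`, `h̄ = h + Σ_j μ_j log|s_j|`
  has a plurisubharmonic extension (Thm. 17, from Thms. 14, 16 and Grauert–Remmert), so that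
  `β = dd^c h̄` off `D` is dominated by the positive current `dd^c h̄` and extends by zero (Skoda–El Mir,
  as recalled in BEGZ §1.2). [cite: BrosnanPearlstein2019, Thms. 14, 16 and 17]
  [cite: BoucksomEtAl2010, §1.2 (Def. 1.2 and the Skoda–El Mir extension theorem)] -/
  massOf_one_lt_top : massOf D pot 1 < ⊤
  /-- **Mass inequality** `M_j ≤ δ^j` (`1 ≤ j ≤ N`): the non-pluripolar power `⟨Ť^j⟩` of the zero
  extension `Ť ∈ δ[ω_FS]` of `β` is the trivial extension of the smooth form `β^j` on `S` (small
  unbounded locus) and `{⟨Ť^j⟩} ≤ {Ť}^j`. [cite: BoucksomEtAl2010, Def. 1.2, Prop. 1.6 and Prop. 1.20] -/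
  massOf_le_pow : ∀ j : ℕ, 1 ≤ j → j ≤ N → massOf D pot j ≤ massOf D pot 1 ^ j

namespace BiextensionHeightPackage

variable {N : ℕ} {D : Set (ℙ ℂ (Fin (N + 1) → ℂ))} (P : BiextensionHeightPackage N D)

/-- The chart potential `g = pot ∘ (1, ·)` on `ℂᴺ = {z₀ ≠ 0}`: a local potential of `β`
(`dd^c g = β` in the chart). [cite: BrosnanPearlstein2019, §1] -/
def chartPotential (w : Fin N → ℂ) : ℝ :=
  P.pot (chartVec w)

/-- `M_j = ∫_S β^j ∧ ω_FS^{N-j} ∈ [0, ∞]`, the (non-pluripolar) Monge–Ampère mass of order `j` of the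
height current. [cite: BoucksomEtAl2010, Def. 1.2 and Prop. 1.6] -/
def massENN (j : ℕ) : ENNReal :=
  massOf D P.pot j

/-- `δ = ∫_S β ∧ ω_FS^{N-1} ∈ [0, ∞]`, the degree of the height current (`= M_1`).
[cite: BoucksomEtAl2010, Def. 1.2] -/
def degreeENN : ENNReal :=
  P.massENN 1

/-- `M_j` as a real number. [cite: BoucksomEtAl2010, Def. 1.2 and Prop. 1.6] -/
def mass (j : ℕ) : ℝ :=
  (P.massENN j).toReal

/-- `δ` as a real number. [cite: BoucksomEtAl2010, Def. 1.2] -/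
def degree : ℝ :=
  P.degreeENN.toReal

/-- Unfolding: `M_j` is the chart integral `massOf D pot j`. [folklore] -/
theorem massENN_def (j : ℕ) : P.massENN j = massOf D P.pot j := rfl

/-- `δ = M_1` (by definition). [folklore] -/
theorem degreeENN_eq_massENN_one : P.degreeENN = P.massENN 1 := rfl

/-- `δ = M_1` for the real-valued versions. [folklore] -/
theorem degree_eq_mass_one : P.degree = P.mass 1 := rfl

/-- `δ < ∞`. [cite: BrosnanPearlstein2019, Thm. 17] [cite: BoucksomEtAl2010, §1.2] -/
theorem degreeENN_lt_top : P.degreeENN < ⊤ := P.massOf_one_lt_top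

/-- `M_j ≤ δ^j` for `1 ≤ j ≤ N`, in `[0, ∞]`. [cite: BoucksomEtAl2010, Prop. 1.20] -/
theorem massENN_le_pow {j : ℕ} (h1 : 1 ≤ j) (hN : j ≤ N) : P.massENN j ≤ P.degreeENN ^ j :=
  P.massOf_le_pow j h1 hN

/-- `M_j < ∞` for `1 ≤ j ≤ N`. [cite: BoucksomEtAl2010, Prop. 1.6 and Prop. 1.20] -/
theorem massENN_lt_top {j : ℕ} (h1 : 1 ≤ j) (hN : j ≤ N) : P.massENN j < ⊤ :=
  (P.massENN_le_pow h1 hN).trans_lt (ENNReal.pow_lt_top P.degreeENN_lt_top)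

/-- `0 ≤ M_j`. [cite: BoucksomEtAl2010, Def. 1.1] -/
theorem mass_nonneg (j : ℕ) : 0 ≤ P.mass j := ENNReal.toReal_nonneg

/-- `0 ≤ δ`. [cite: BoucksomEtAl2010, Def. 1.1] -/
theorem degree_nonneg : 0 ≤ P.degree := ENNReal.toReal_nonneg

/-- **`0 ≤ M_j ≤ δ^j`** for `1 ≤ j ≤ N` (real-valued form consumed by `MassDefect`).
[cite: BoucksomEtAl2010, Prop. 1.20] -/
theorem mass_le_degree_pow {j : ℕ} (h1 : 1 ≤ j) (hN : j ≤ N) : P.mass j ≤ P.degree ^ j := by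
  rw [mass, degree, ← ENNReal.toReal_pow]
  exact ENNReal.toReal_mono (ENNReal.pow_ne_top P.degreeENN_lt_top.ne) (P.massENN_le_pow h1 hN)

/-- The mass defect of order `j` is non-negative: `0 ≤ δ^j - M_j`. [cite: BoucksomEtAl2010, Prop. 1.20] -/
theorem sub_mass_nonneg {j : ℕ} (h1 : 1 ≤ j) (hN : j ≤ N) : 0 ≤ P.degree ^ j - P.mass j :=
  sub_nonneg.2 (P.mass_le_degree_pow h1 hN)

/-- Over `S` the potential is log-homogeneous on the whole punctured line through `v`:
`pot (c • v) - pot v = d log|c|`. [cite: BrosnanPearlstein2019, Thm. 137 and Rem. 138] -/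
theorem pot_smul_sub (c : ℂ) (hc : c ≠ 0) {v : Fin (N + 1) → ℂ}
    (hv : v ∉ Projectivization.conePreimage D) :
    P.pot (c • v) - P.pot v = P.extDegree * Real.log ‖c‖ := by
  rw [P.pot_smul c v hc hv]; ring

/-- Unit scalars do not change the potential over `S` (`pot` descends along the Hopf fibration).
[cite: BrosnanPearlstein2019, Prop. 24] -/
theorem pot_smul_of_norm_eq_one {c : ℂ} (hc : ‖c‖ = 1) {v : Fin (N + 1) → ℂ}
    (hv : v ∉ Projectivization.conePreimage D) : P.pot (c • v) = P.pot v := by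
  have hc0 : c ≠ 0 := fun h ↦ by simp [h] at hc
  rw [P.pot_smul c v hc0 hv, hc, Real.log_one, mul_zero, add_zero]

end BiextensionHeightPackage

end Literature.AlgebraicGeometry.HodgeTheory

end
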